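import Mathlib
import HarnessLib
import HarnessLib.Audit
import Summits.ABC.Statement
import HarnessLib.Audit.Status.Attr

/-!
Route: ExceptionalSetEnergy

DORMANT since 2026-08-23T09:40:52Z (reconciler: no traction for 6 d (last activity item-evidence-added at 2026-08-17T08:00:42Z); parked, not closed — `ledger route dormant route-ABC-ExceptionalSetEnergy --off` to reactivate) — unstaffed, not closed; items shared with open routes are served there. `ledger route dormant <id> --off` reactivates.

Route ExceptionalSetEnergy — card exceptional-set-additive-energy (new-combination). A
consequence-side MILESTONE LADDER in the counting language of the abc exceptional set (same shape as
route RiemannHypothesis/Strip: X ⟺ S by a printed dictionary, cruxes = rungs strictly between the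
known and X; the moment method's own floor, exponent 1/2, is declared).

THESIS X (it suffices to show; words): for every λ < 1 the number N_λ(X) of abc triples (coprime
positive a + b = c ≤ X) with rad(abc) < c^λ is bounded independently of X — the counting form of abc
(Lichtman 2025, arXiv:2505.13991 p. 3: "abc ⟺ |E(N)| = O_ε(1)"). Assembly X → ABC is elementary
(bounded nested counts ⟹ finite exceptional set ⟹ C(ε) := 2 + Σ exceptional c; λ ↔ any l ∈ (1/(1+ε),
1)).
X as one line (decl CountingForm): ∀ l : ℝ, l < 1 → ∃ B : ℕ, ∀ X : ℕ, ncard {t | IsABCTriple t.1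
t.2.1 t.2.2 ∧ t.2.2 ≤ X ∧ (rad t : ℝ) < (t.2.2 : ℝ) ^ l} ≤ B.

THE LINE (mechanism): bound every dyadic shape-piece count of exceptional triples by the asymmetric
moment inequality #{a+b=c : a∈A, b∈B, c∈C}² ≤ |A|·E[B,C] (Mathlib
`Finset.card_sq_le_card_mul_addEnergy`) and E[B,C]² ≤ E[B]·E[C] (support MixedEnergyCauchySchwarz),
so that the analytic content of the exceptional-set problem becomes ONE question: how much of the
POWER part y = x₂²x₃³⋯ of a Bernert–Browning–Lichtman–Teräväinen shape n = x₁·y (x₁ = squarefree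
'linear' variable) is saved in the FOURTH MOMENT (additive energy). BBLT v2 Prop 3.1 saves the
variables x_j with i | j for ONE i; Shute's Prop 3.2 (Campana points, squareful shapes x²y³) saves x
and y^{1/3}; the conjectural full saving (E1′): E(B) ≪ X^ε(|B|³/|Y| + |B|⁴/X), |Y| = the number of
power parts, is worth N_1(X) ≪ X^{4/7+ε} already against Bernert's basic geometry-of-numbers bound
X^λ/P₁ + X^{λ−1} alone (planner's optimisation, saddle at squarefree ranges X^{1/7} each); the
optimistic PS′: E ≪ X^ε(|B|² + X₁³|Y| + |B|⁴/X) is worth 6/11; Parseval puts the floor of every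
moment method at 1/2. Records (checked on arXiv this session): 2/3 trivial, PROVED in tree
(ABCHitCountUpperBound_holds); BBLT v2 = Bernert–Browning–Lichtman–Teräväinen 2026, Thm 1.2:
(23λ+3)/40+ε for λ ∈ (0,2] (0.65 at λ = 1), Thm 1.3: 0.6+ε for every λ < 1 (mixed-integer LP over
their two bounds; λ = 1 not covered); v1 33/50; Li 56/85. The squareful/powerful corner is where the
Campana-points literature already did the work: E(Powerful ≤ X) ≪ X^{1+ε} follows from Shute 2021
Prop 3.2 by subadditivity of E^{1/4} over dyadic y-ranges (support PowerfulAlmostSidon — the card's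
T′ is KNOWN), and all coprime squareful a+b=c ≤ B number ≪ B^{3/5} log¹² B (Browning–Van
Valckenborgh Thm 2; conjecturally cB^{1/2}).

TWO-LAYER PLAN (D-0019). Cruxes first: rank 2 HitCountFourSevenths (abcHitCount X ≪_ε X^{4/7+ε} at λ
= 1: below the BBLT v2 LP value 0.6 and at the endpoint their Thm 1.3 excludes; the deliverable of
(E1′)); rank 3 LinearShapeEnergy ((E1′) for the simplest shape beyond BBLT's one-divisibility-class
saving: E[{x y² z³ : x ≤ X₁, y ≤ Y, z ≤ Z}] ≪ (X₁YZ)^ε X₁³Y²Z² — saves Y and Z simultaneously); rank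
4 PowerfulHitsSquareRoot (hits with abc powerful ≪ X^{1/2+ε}: the square-root law in the pure
power-rich corner; known 3/5); rank 5 SquarefulShapeEnergy (E[{x²y³ : x ≤ X, y ≤ Y squarefree}] ≪
(XY)^ε X²Y²: Shute's exponent 8/3 on Y lowered to 2 = PS for squareful shapes; it is
LinearShapeEnergy at X₁ = 1 up to the squarefree convention and feeds rank 4). Glue later: the shape
decomposition (BBLT Prop 2.1), the radical refinement of pieces and the η/LP-optimisation are NOT
filed until a crux closes; supports filed now: MixedEnergyCauchySchwarz (provable now,
Mathlib-grade), PowerfulAlmostSidon (known: formalise Shute §3, elementary), RadicallySmallNotSidon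
(negative knowledge: 'radically small ⟹ almost Sidon' is false; all additive structure sits in the
squarefree variable — provable now from AbcHits.card_radFibre_le).

Rationale: WHY THIS LINE. The only unconditional theorems ABOUT abc triples proved in 2024–26 are
exceptional-set counts: BernertEtAl2024 (arXiv:2410.12234; v2 of 9 May 2026 is 4-author: Thm 1.2
(23λ+3)/40+ε on (0,2], Thm 1.3 0.6+ε for λ<1 via a mixed-integer LP; v1 Thm 1.2 33/50), Bernert2025
(merged into v2), Li2025ExceptionalSet (56/85), Lichtman2025 (elementary 2/3, in tree as
ABCHitCountUpperBound_holds). Their Fourier step is a fourth moment in disguise (v2 Prop 3.1 /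
Bernert2025 Prop 3: ∫|S|⁴ ≪ X^ε(ΠA_i)³/Π_{i|j}A_j — one divisibility class of power variables
saved). The card's move is to make the additive energy of the shape pieces THE object via the
asymmetric L²·L⁴·L⁴ inequality (first half is Mathlib's card_sq_le_card_mul_addEnergy), and to
import the area that already computes such energies: Campana points with squareful coordinates
(Shute2021 Prop 3.2/Thm 1.1, BrowningYamagishi2021 Thm 1.2, Vanvalckenborgh2012,
BrowningValckenborgh2012, PieropanEtAl2020) — cited by none of the abc papers (reference lists
checked on the page; v2 checked on arXiv HTML: no 'energy', 'squareful', 'Campana', 'Shute').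
Imported: additive combinatorics (energy; E^{1/4} is a norm), Heath-Brown's circle method for
quaternary quadrics uniform in coefficients (HeathBrown1996Crelle481, via Shute), determinant method
(via Browning–Van Valckenborgh), geometry of numbers (Bernert Prop 2 / v2 Prop 4.1). IN-TREE STATE
(2026-08-16): BBLT v2 Thm 1.2 ((23λ+3)/40, i.e. 13/20 at λ = 1) and Thm 1.3 (0.6+ε for 0<λ<1) are
PROVED in Literature (bernertEtAl2024_thm_1_2_holds, bernertEtAl2024_thm_1_3_holds) on top of a
formalised shape-reduction / Fourier / geometry-of-numbers / LP pipeline (AbcShapeReduction*,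
AbcShapeFourierBound*, AbcShapeGeometrySets, AbcLinearProgram), so rung provers start from
kernel-checked records; abcExponentCount_finite / _mono_right serve the Assembly.
WHAT THE PLANNER COMPUTED (scratch/opt3.py; numbers): members parametrised by (squarefree-range
exponent s, power-part count exponent t), s+2t ≤ 1, Σ(s+t) ≤ 1; N_1 ≤ X^ε max over shapes of
min(Energy L²L⁴L⁴, basic GoN X/P₁, trivial pairs). Full power-part saving (E1′) ⟹ 4/7 = 0.5714
(saddle s_i = 1/7); PS′ ⟹ 6/11 = 0.5455; floor 1/2. With BBLT's refined GoN the reach can only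
improve. So the honest window of the line at λ = 1 is [1/2, 4/7] versus the record 0.65 (λ = 1) /
0.6 (λ < 1); the rank-2 milestone is set AT 4/7.
LITERATURE FINDING (changes the card): T′ 'E(Powerful(X)) = X^{1+o(1)}' is KNOWN — ≫ X log X by
BrowningYamagishi2021 Thm 1.2 (thin set z₁z₂z₃z₄ = □, split quadrics) and ≪ X^{1+ε} from Shute2021
Prop 3.2 (N(X,Y) ≪ (ΠX_i)^{1/2+ε}(ΠY_i)^{2/3+ε} ⟹ E(shape y~R) ≪ X^{1+ε}R^{-1/3}, summed by
subadditivity of E^{1/4}). Filed as support PowerfulAlmostSidon, not as a crux.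
RANKED CRUXES. (2) HitCountFourSevenths — hardest rung; validates the whole line; closable by any
method. (3) LinearShapeEnergy — the engine's atomic new estimate: save two power variables at once
next to a linear one; GoN-in-x handles YZ ≤ X₁^{3/2} up to sums of inverse successive minima, the
complement needs paucity in (y,z) with small x-coefficients; a second Cauchy–Schwarz arrangement
(x(m) = x′(m′), m = y₁²z₁³ − y₂²z₂³) is the suggested first attack. (4) PowerfulHitsSquareRoot —
square-root law in the power-rich corner; known 3/5 (BrowningValckenborgh2012 Thm 2 for ALL
squareful a+b=c; their Conj. 1: cB^{1/2}); energy route: Shute-level input gives 11/18 for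
generic-radical pieces, SquarefulShapeEnergy gives 1/2. (5) SquarefulShapeEnergy — most tractable:
improve Shute's Y^{8/3} to Y²; the loss sits in his L_k(X,Y) step. (0 = the X slot) CountingForm —
NOT a rung: the thesis X itself (≡ abc in counting form), carried as a CRUX (kind crux, rank 0,
planner-HELD = not served) since the 2026-08-16 route-choice (target-unreachable: no item concludes
X, and none honestly can — power-saving counts never bootstrap to O(1); conjecture-grade statements
sit only as cruxes, D-0027 §2.2). `closes` uses exactly CountingForm + Assembly; ranks 2–5 close
with X untouched. Held so that no prover / disprover / crux-ideation seat goes to abc itself through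
this route (ideas for abc-by-counting belong to the summit's cards); expected refuter stamp
'open-problem (≡ ABC)'. Why this form: counting is the only form of abc with unconditional
all-triple theorems, exposing it to moment / geometry-of-numbers / determinant methods — whose floor
(exponent λ/2) is declared; O(1) is not claimed reachable by them.
KILL CRITERIA. (a) LinearShapeEnergy or SquarefulShapeEnergy refuted (exact energies by FFT on boxes
up to 10³–10⁴ per variable, or a structured family with E ≥ bound·(size)^κ): the engine is dead —
close 'refuted:<Decl>' unless rank 2 has moved by other means. (b) A proof that even with (E1′) the
LP/η-optimisation cannot pass 0.6 at λ = 1 (planner's model wrong: GoN '1+' terms, radical-refined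
pieces, cofactors): rank 2 out of reach — keep the stand-alone statements, close 'exhausted' with
census. (c) 4/7 or better at λ = 1 appears in print: cite, close rank 2 as known, re-aim (6/11, then
1/2+ε = the floor). (d) Lifecycle, not mathematics: if the judge panel / operator rule that a
declared ladder (summit-equivalent crux + milestones) is not a thesis, the disposition is 'retire as
a route, KEEP the items' (2708–2715 are stand-alone, vetted, two provable now, one with a proof in
hand).
NOT DECOMPOSED YET. (E1′) for general d (BBLT's shape reduction Prop 2.1 is already formalised in
Literature); the radical refinement of pieces; sums of inverse successive minima over power-rich
quadruples; thin-set/non-primitive bookkeeping; general λ; the CountingForm ⟸ ABC direction (not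
needed); no decomposition of CountingForm is filed or foreseen (see RANKED CRUXES, the X slot).
CHEAPEST FALSIFIER. Exact additive energies by FFT/direct count for the two shape cruxes
(LinearShapeEnergy boxes (X₁,Y,Z) incl. the YZ > X₁^{3/2} regime; SquarefulShapeEnergy boxes to
(80,80)/(10,300)/(3000,2)): a ratio E/bound growing like a power inside a family kills the engine
(kill criterion (a)). Run by refuters as kit jobs j000146 / j000150 / j000786 (evidence on
stmt-ABC-2709 / 2711): flat or decreasing so far (ratios ≤ 3.3, the only values > 1.5 in the
sums-of-two-squares corners = the log inside (size)^ε).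

Novelty: Nearest prior art (searched this session: lit read + page grep of arXiv:2410.12234 v1 (pp. 1–8, 15:
Props 1.1, 2.1, 3.1, 3.2, 3.5, 3.6, Thm 1.2, references), arXiv:2506.13364 (whole note: Thm 1, Props
2–3, Remark 8/13), arXiv:2507.02885 (Thm 1.3 = 56/85), arXiv:2505.13991 (Thm 1.1, 'abc ⟺ |E(N)| =
O_ε(1)'), arXiv:2104.06966 (Shute: Thm 1.1, Thm 1.3, Props 3.1–3.2 with proof), arXiv:1902.07782
(Browning–Yamagishi Thms 1.1–1.2 and the proof of 1.2), arXiv:1106.4472 (Browning–Van Valckenborgh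
Thms 1–2); zbMATH/crossref legs for 'sums of two squarefull numbers' (Blomer2004, Blomer 2005, Odoni
1981, Baker–Brüdern 1994: counts of representable n, no second moments), 'Campana points' 2019–2026
(25 rows; none treats the energy use for abc), 'squareful numbers' 2010+; lit galaxy --star all
'sums of two squareful/powerful numbers' (3 irrelevant book hits); Mathlib
Combinatorics/Additive/Energy.lean (card_sq_le_card_mul_addEnergy present, E[s,t]² ≤ E[s]E[t]
absent); OpenAlex/S2/arXiv API legs rate-limited (HTTP 429); the CURRENT version of 2410.12234 (v2,
9 May 2026, Bernert–Browning–Lichtman–Teräväinen) was read on arXiv HTML this session: Thm 1.2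
(23λ+3)/40+ε on (0,2], Thm 1.3 0.6+ε for λ ∈ (0,1) by a mixed-integer LP, Prop 3.1 fourth moment
saving Π_{i|j}A_j, Prop 4.1 refined geometry of numbers, no determinant method, no
'energy'/'squareful'/'Campana'/'Shute'.
KNOWN: the Fourier/fourth-moment step (BernertEtAl2024 Prop 3.1; Bernert2025 Prop 3, one-variable
saving); exceptional-set r  [refs: 2410.12234, 2506.13364, 2507.02885, 2505.13991, 2104.06966, 1902.07782, 1106.4472, Blomer2004, BernertEtAl2024, Bernert2025, Shute2021, BrowningYamagishi2021, BrowningValckenborgh2012]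

Barriers (technique_class: additive-energy fourth-moment campana-points exc-set-counting): technique_class: additive-energy fourth-moment campana-points exc-set-counting (in words: asymmetric
moment inequality L2·L4·L4, additive energy of BLT shape pieces, Campana-point counts for squareful
coordinates via the circle method for quaternary quadrics, geometry of numbers for the squarefree
variables)
- Literature.Barriers.ABC.EpsilonCannotBeDropped: not engaged — every item is a COUNT with X^ε
losses (or an O(1) count for λ < 1, which is abc itself); Stewart–Tijdeman/van Frankenhuysen
families contribute X^{o(1)} triples per scale, invisible at exponents ≥ 1/2; no ε-free inequality
for all triples is asserted anywhere.
- Literature.Barriers.ABC.BakerMethodBounds: not in the class — no linear forms in logarithms; the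
inputs are moment inequalities, divisor bounds, lattice-point counts and circle-method asymptotics
for quadrics.
- Literature.Barriers.ABC.ExplicitABCQualityFloor, BakerShapeConstantFloor,
HallExponentSharp(+Narrow), NConjectureExponentSharp(+Narrow), TijdemanZagierNeedsExponentThree,
UniformABCDiscriminantSharp, UniformABCImpliesNoSiegelZeros, OWeakUniformABCImpliesNoSiegelZeros,
SzpiroEpsilonCannotBeDropped, ErdosWoodsTwoFails: not engaged — no all-triple inequality, no
n-term/Hall/Szpiro/uniform statement is claimed.
- Literature.Barriers.ABC.IntegersHaveNoDerivation(+MasonStothersFailsInCharP, +Narrow): not engaged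
— nothing is transferred from k[t]; the method is native to ℤ (counting).
- Literature.Barriers.ABC.IUTDisputedClaim: not engaged — nothing

History (route lifecycle, newest last):
- 2026-08-23T09:40:52Z · DORMANT — reconciler: no traction for 6 d (last activity item-evidence-added at 2026-08-17T08:00:42Z); parked, not closed — `ledger route dormant route-ABC-ExceptionalSet (operator:999:2480321)

sub-problem: ABC · status: dormant · opened planner-plancard-ABC-ABC-exceptional-set-addi-899419c1-0 2026-08-15T11:07:10Z · rev 8 · ledger route-ABC-ExceptionalSetEnergy
GENERATED by the gate from the ledger (D-0016/17). Provers cite these decls: `theorem foo : Summit.ABC.ABC.Theses.ExceptionalSetEnergy.<Decl> := …` in Summits/ABC/ABC/Theorems/<Name>.lean.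
-/

namespace Summit.ABC.ABC.Theses.ExceptionalSetEnergy

open scoped BigOperators Topology Manifold Classical MeasureTheory ProbabilityTheory Matrix InnerProductSpace ComplexConjugate ContinuousMap
open Filter Set Function TopologicalSpace MeasureTheory

attribute [summit_statement] _root_.ABC

open Literature.Abc

/-- item stmt-ABC-2707 · crux · rank 0 · open · by planner
why it might fail: ≡ abc itself in counting form (Lichtman2025 p.3; BBLT §1): open for EVERY fixed l<1 (no c ≪ rad^K known for any K; Stewart–Yu is exp(rad^{1/3+ε})). No rung reaches it: moment methods floor at exponent λ/2 (Parseval) and nothing lifts N_λ(X) ≪ X^θ to O(1); it decides the route alone.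
sources: Lichtman2025, BernertEtAl2024, Oesterle1988, BombieriGubler2006, lean: Literature.NumberTheory.DiophantineGeometry.stewart_yu, lean: Literature.Barriers.ABC.BakerMethodBounds
[target] Thesis X, the counting form of abc: for every real l < 1 the number N_l(X) of abc triples
(a,b,c) (IsABCTriple: positive, coprime, a+b=c) with c <= X and rad(abc) < c^l is bounded by some B
independent of X (the sets are finite, inside [0,X]^3, so ncard is honest; for l <= 0 they are
empty). Equivalent to ABC (Lichtman2025 p.3: 'abc <=> |E(N)| = O_eps(1)'; BernertEtAl2024 §1); the
Assembly files the direction X -> ABC. As a PLAN it has no rung mechanism of its own: the cruxes are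
milestones strictly between the known (2/3; 33/50; 56/85; v2: (23 lambda+3)/40, 0.6 for lambda<1)
and X, and the moment method's floor is exponent 1/2 (Parseval), so all cruxes can close with X
untouched — an honest partial-result ladder (cf. route RiemannHypothesis/Strip). -/
@[route_item "route-ABC-ExceptionalSetEnergy", crux]
def CountingForm : Prop :=
  ∀ l : ℝ, l < 1 → ∃ B : ℕ, ∀ X : ℕ, {t : ℕ × ℕ × ℕ | Literature.NumberTheory.DiophantineGeometry.IsABCTriple t.1 t.2.1 t.2.2 ∧ t.2.2 ≤ X ∧ ((Literature.NumberTheory.DiophantineGeometry.rad t.1 t.2.1 t.2.2 : ℕ) : ℝ) < (t.2.2 : ℝ) ^ l}.ncard ≤ B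

/-- item stmt-ABC-2708 · crux · rank 2 · open · by planner
why it might fail: 4/7 is the value of a 3-member model (energy | basic GoN | pairs) ASSUMING the full power-part saving (E1′), proved so far for ONE divisibility class only (BBLT v2 Prop 3.1); GoN '1+' terms, radical-refined pieces, cofactors are ignored; λ = 1 is the endpoint v2 Thm 1.3 (0.6 for λ<1) excludes.
sources: BernertEtAl2024, Bernert2025, Li2025ExceptionalSet, Lichtman2025, Kane2015, lean: Literature.NumberTheory.DiophantineGeometry.ABCHitCountUpperBound_holds
[crux] Exceptional-set milestone AT lambda = 1: abcHitCount X (= N_1(X) = # abc triples c <= X with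
rad(abc) < c; Literature.NumberTheory.DiophantineGeometry.abcHitCount) <<_eps X^{4/7+eps}. Records
(arXiv checked this session): 2/3+eps trivial (PROVED in tree: ABCHitCountUpperBound_holds);
BernertEtAl2024 v2 (Bernert-Browning-Lichtman-Teravainen, 9 May 2026) Thm 1.2: (23 lambda+3)/40+eps
on (0,2] => 0.65 at lambda = 1; Thm 1.3: 0.6+eps for every lambda < 1 (constant depends on lambda;
mixed-integer LP over their Fourier Prop 3.1 + geometry-of-numbers Prop 4.1; lambda = 1 NOT
covered); v1 33/50; Li2025ExceptionalSet 56/85. THE LINE: N_1 <= X^eps max_shapes min{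
|A|^{1/2}(E(B)E(C))^{1/4}, X/P_1 + 1 (Bernert Prop 2), |A||B| }; with the full power-part saving
(E1'): E(B) << X^eps(|B|^3/|Y| + |B|^4/X) for every shape B = {x_1 y}, the planner's optimisation
gives exactly 4/7 = 0.5714 (saddle: squarefree ranges X^{1/7} each) using only the basic GoN bound;
v2's refined GoN can only lower it; PS' gives 6/11; floor 1/2. Closable by ANY method (a published
X^{4/7} at lambda = 1 closes it by citation). -/
@[route_item "route-ABC-ExceptionalSetEnergy", crux]
def HitCountFourSevenths : Prop :=
  ∀ ε : ℝ, 0 < ε → ∃ C : ℝ, ∀ X : ℕ, 2 ≤ X → (Literature.NumberTheory.DiophantineGeometry.abcHitCount X : ℝ) ≤ C * (X : ℝ) ^ (4 / 7 + ε : ℝ)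

/-- item stmt-ABC-2709 · crux · rank 3 · open · by planner
why it might fail: No slack to lose: random collisions already give ≍ X₁³Y²Z (room = Z only; Z = 1 is BBLT's tight one-class case X₁³Y²). Lattice counting in x has a '+1' term (YZ)⁴ beating X₁³Y²Z² once YZ > X₁^{3/2}, and the m ≠ 0 ratio count x(m) = x′(m′) may carry (YZ)²X₁^{1+κ} from popular m.
sources: BernertEtAl2024, Bernert2025, Shute2021, HeathBrown1996Crelle481, TaoVu2006
[crux] (E1') in its simplest instance beyond BBLT: for S = {x y^2 z^3 : 1 <= x <= X_1, 1 <= y <= Y,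
1 <= z <= Z} (image set; the BBLT shape (1,2,3) without its squarefree/coprimality conditions, which
only shrink S), E[S,S] <<_eps (X_1 Y Z)^eps X_1^3 Y^2 Z^2, i.e. |S|^3/(YZ): BOTH power variables
saved next to the linear one. General form (E1'): E(B) << X^eps(|B|^3/|Y| + |B|^4/N) for B = {x_1 y
: y in Y (power parts)}, N = sup B; here |B|^4/N = X_1^3 Y^2 Z <= the bound. KNOWN: trivial |S|^3 =
X_1^3Y^3Z^3; Bernert2025 Prop 3 / BernertEtAl2024 v2 Prop 3.1 (fourth moment saves prod_{i|j} A_j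
for ONE i): X_1^3 Y^3 Z^3 / max(Y,Z) — for one power variable ({x y^2} or {x z^3}) that is already
optimal, so two power variables is the first new case. Heuristic truth max(X_1^3 Y^2 Z random, X_1^3
YZ same-(y,z), X_1^2Y^2Z^2 diagonal) — slack >= min(Y,Z,X_1/..) everywhere; corners: Y=Z=1 gives
E([1,X_1]) ~ X_1^3 (tight), X_1=Z=1 squares Y^2 log Y, X_1=Y=1 cubes 2Z^2. Two regimes: YZ <=
X_1^{3/2}: geometry of numbers in x for fixed (y,z)-quadruples (main term X_1^3Y^2Z; needs sums of
inverse successive minima of {x : sum x_i y_i^2 z_i^3 = 0}); YZ > X_1^{3/2}: paucity in (y,z) with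
small x-coeffic -/
@[route_item "route-ABC-ExceptionalSetEnergy", crux]
def LinearShapeEnergy : Prop :=
  ∀ ε : ℝ, 0 < ε → ∃ C : ℝ, ∀ X₁ Y Z : ℕ, 1 ≤ X₁ → 1 ≤ Y → 1 ≤ Z → let S : Finset ℕ := (Finset.Icc 1 X₁ ×ˢ Finset.Icc 1 Y ×ˢ Finset.Icc 1 Z).image (fun p : ℕ × ℕ × ℕ => p.1 * p.2.1 ^ 2 * p.2.2 ^ 3); (Finset.addEnergy S S : ℝ) ≤ C * ((X₁ : ℝ) * Y * Z) ^ ε * (X₁ : ℝ) ^ 3 * (Y : ℝ) ^ 2 * (Z : ℝ) ^ 2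

/-- item stmt-ABC-2710 · crux · rank 4 · open · by planner
why it might fail: Hits inherit B–VV's B^{1/5} bottleneck: Lemma 3 (conics/cubics) + radical fibres give B^{1/2+ε} unless B^{1/2} < Πy_i ≤ (Πx_i)^{4/3}; there, triples with x_i ~ y_i ~ B^{1/5}, x_i carrying a B^{1/15}-chunk of y_i's primes, are ALL hits, nearly every x occurs, and all known bounds = #curves = B^{3/5}.
sources: BrowningValckenborgh2012, Shute2021, BrowningYamagishi2021, PieropanEtAl2020, BernertEtAl2024, arXiv:2302.08164
[crux] Square-root law in the pure power-rich corner: the number of abc hits (c <= X, rad(abc) < c)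
with abc POWERFUL (every prime factor of abc divides it twice; for pairwise coprime a,b,c this says
a, b, c are each powerful) is <<_eps X^{1/2+eps}. Trivial: X^{2/3+eps} (pairs of radicals); KNOWN:
<< X^{3/5} log^12 X for ALL coprime squareful a+b=c (BrowningValckenborgh2012 Thm 2, determinant
method; their Thm 1 and Conjecture 1: the full count is ~ c X^{1/2}, so hits are a sub-count of a
set of size X^{1/2+o(1)} and the statement is safe truth-wise; B-VV p.3: beating 3/5 needs a new
treatment of the x_i, y_i ~ B^{1/5} regime). Energy route: pieces A,B,C = squareful shapes {x^2 y^3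
: y ~ R} refined by radical; hit condition => |A||B||C| <= X^{1+eps}; #hits <=
|A|^{1/2}(E(B)E(C))^{1/4}: Shute2021 Prop 3.2 (E << |S|^2 R^{2/3}) gives 11/18 for generic-radical
pieces, SquarefulShapeEnergy (E << |S|^{2+eps}) gives 1/2; small-radical pieces go to the trivial
slot |B||C|. -/
@[route_item "route-ABC-ExceptionalSetEnergy", crux]
def PowerfulHitsSquareRoot : Prop :=
  ∀ ε : ℝ, 0 < ε → ∃ C : ℝ, ∀ X : ℕ, 2 ≤ X → ({t : ℕ × ℕ × ℕ | Literature.NumberTheory.DiophantineGeometry.IsABCTriple t.1 t.2.1 t.2.2 ∧ t.2.2 ≤ X ∧ Literature.NumberTheory.DiophantineGeometry.rad t.1 t.2.1 t.2.2 < t.2.2 ∧ ∀ p ∈ (t.1 * t.2.1 * t.2.2).primeFactors, p ^ 2 ∣ t.1 * t.2.1 * t.2.2}.ncard : ℝ) ≤ C * (X : ℝ) ^ (1 / 2 + ε : ℝ)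

/-- item stmt-ABC-2711 · crux · rank 5 · open · by planner
why it might fail: Zero slack in Y: the diagonal alone is ≍ X²Y². The balanced regime x ~ X, y ~ Y with k = gcd(x,y) structure may carry X²Y^{2+κ} solutions of x²(y₁³−y₂³) = k y³(x₁²−x₂²); Shute's min(UY/k², kX²/U) step loses exactly Y^{2/3}; removing it likely needs determinant/lattice input beyond divisor bounds.
sources: Shute2021, BrowningYamagishi2021, Vanvalckenborgh2012, HeathBrown1996Crelle481, BrowningValckenborgh2012
[crux] PS for squareful shapes ('squareful shapes are almost Sidon'): for S = {x^2 y^3 : 1 <= x <=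
X, 1 <= y <= Y, y squarefree} (|S| = (6/pi^2+o(1)) XY, x^2y^3 injective), E[S,S] <<_eps (XY)^eps X^2
Y^2. Diagonal gives >= 2|S|^2 - |S| ~ 0.74 X^2Y^2, random collisions |S|^4/(X^2Y^3) = X^2 Y <=
X^2Y^2, so the claim is 'no further coincidences'. KNOWN: Shute2021 Prop 3.2 (proof pp. 9-10:
Hoelder, two Cauchy-Schwarz, divisor bounds on x^2(y_1^3 - y_2^3) = k y^3(x_1^2 - x_2^2)) gives
X^{2+eps} Y^{8/3+eps}; trivial X^3Y^3. The Y^{2/3} is lost in the L_k(X,Y) step (min(UY/k^2, kX^2/U)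
interpolation). It is LinearShapeEnergy at X_1 = 1 up to the squarefree convention. Consequence:
E(shape y ~ R inside Powerful(N)) << N^{1+eps}/R (vs Shute N^{1+eps}R^{-1/3}), which is what
PowerfulHitsSquareRoot consumes. Numerically refutable: exact E[S] by FFT for X, Y <= 10^3. -/
@[route_item "route-ABC-ExceptionalSetEnergy", crux]
def SquarefulShapeEnergy : Prop :=
  ∀ ε : ℝ, 0 < ε → ∃ C : ℝ, ∀ X Y : ℕ, 1 ≤ X → 1 ≤ Y → let S : Finset ℕ := (Finset.Icc 1 X ×ˢ (Finset.Icc 1 Y).filter Squarefree).image (fun p : ℕ × ℕ => p.1 ^ 2 * p.2 ^ 3); (Finset.addEnergy S S : ℝ) ≤ C * ((X : ℝ) * Y) ^ ε * (X : ℝ) ^ 2 * (Y : ℝ) ^ 2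

/-- item stmt-ABC-2712 · support · rank 9 · open · by planner
sources: mathlib: Finset.card_sq_le_card_mul_addEnergy, TaoVu2006
[support] Mixed-energy Cauchy-Schwarz, the second half of the reduction (the first half, #{(a,b) in
A x B : a+b in C}^2 <= |C| * E[A,B], is Mathlib's Finset.card_sq_le_card_mul_addEnergy): for finite
s, t in N, E[s,t]^2 <= E[s,s] * E[t,t], where E[s,t] = Finset.addEnergy s t = #{(a_1,a_2,b_1,b_2) in
s x s x t x t : a_1 + b_1 = a_2 + b_2}. Proof: E[s,t] = sum_n d_s(n) d_t(-n) with d_s(n) =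
#{(a_1,a_2) in s^2 : a_1 - a_2 = n} (cast to Z), Cauchy-Schwarz, and sum_n d_s(n)^2 = E[s,s].
Provable now; Mathlib-grade lemma (prove it for any AddCommGroup / cancellative monoid via the
embedding N -> Z and specialise). -/
@[route_item "route-ABC-ExceptionalSetEnergy", crux]
def MixedEnergyCauchySchwarz : Prop :=
  ∀ s t : Finset ℕ, Finset.addEnergy s t ^ 2 ≤ Finset.addEnergy s s * Finset.addEnergy t t

/-- item stmt-ABC-2713 · support · rank 9 · open · by planner
sources: Shute2021, BrowningYamagishi2021, Blomer2004
[support] 'Powerful numbers are almost Sidon' (the card's T'), KNOWN: for P = {n <= X : p | n => p^2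
| n}, E[P,P] <<_eps X^{1+eps} (and >> X log X from squares / BrowningYamagishi2021 Thm 1.2). Proof
from the literature: P = disjoint union over dyadic R <= X^{1/3} of S_R = {x^2y^3 <= X : y
squarefree, y ~ R}; Shute2021 Prop 3.2 (N(X,Y) << (prod X_i)^{1/2+eps}(prod Y_i)^{2/3+eps}, signed
squarefree y allowed) gives E[S_R] << X^eps (X/R^3) R^{8/3} = X^{1+eps} R^{-1/3}; E^{1/4} is a norm
(||hat 1_A||_4), so E[P]^{1/4} <= sum_R E[S_R]^{1/4} << X^{(1+eps)/4} sum_j 2^{-j/12}. Lean route: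
formalise Shute §3 (2 pages, elementary: orthogonality can be replaced by direct counting, Hoelder
by repeated Cauchy-Schwarz on counts, divisor bound tau(n) << n^eps) or prove it under the named
fact (cite item filed). Seed data (card): E/|P|^2 = 5.7, 7.0, 8.1 at X = 10^4, 10^5, 10^6. -/
@[route_item "route-ABC-ExceptionalSetEnergy", crux]
def PowerfulAlmostSidon : Prop :=
  ∀ ε : ℝ, 0 < ε → ∃ C : ℝ, ∀ X : ℕ, 2 ≤ X → let P : Finset ℕ := (Finset.Icc 1 X).filter (fun n => ∀ p ∈ n.primeFactors, p ^ 2 ∣ n); (Finset.addEnergy P P : ℝ) ≤ C * (X : ℝ) ^ (1 + ε)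

/-- item stmt-ABC-2714 · support · rank 9 · open · by planner
sources: lean: Literature.NumberTheory.DiophantineGeometry.AbcHits.card_radFibre_le, BernertEtAl2024, TaoVu2006
[support] Negative knowledge (structure lemma of the card): the naive heuristic 'radically small
integers are additively unstructured' is FALSE. For B(X) = {1 <= n <= X : rad(n)^2 <= X}: B contains
2^K * {odd squarefree m <= sqrt X / 2} with 2^K ~ sqrt X, a dilate of a positive-density set, so
E[B,B] >= |D|^4/|D+D| >> X^{3/2}; while |B(X)| <= K_delta X^{1/2+2 delta} (in tree:
Literature.NumberTheory.DiophantineGeometry.AbcHits.card_radFibre_le summed over r <= sqrt X; de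
Bruijn). Hence E[B] <= C X^eps |B|^2 fails for eps + 4 delta < 1/2. Moral recorded for ideators: ALL
additive structure of radically small numbers sits in the squarefree (linear) variable x_1, which is
why (E1') charges |B|^3/|Y| and PS' charges X_1^3|Y|, and why BBLT's geometry-of-numbers bound
(strong when x_1-ranges are large) is exactly complementary to the energy bound. Provable now. -/
@[route_item "route-ABC-ExceptionalSetEnergy", crux]
def RadicallySmallNotSidon : Prop :=
  ¬ (∀ ε : ℝ, 0 < ε → ∃ C : ℝ, ∀ X : ℕ, 2 ≤ X → let B : Finset ℕ := (Finset.Icc 1 X).filter (fun n => UniqueFactorizationMonoid.radical n ^ 2 ≤ X); (Finset.addEnergy B B : ℝ) ≤ C * (X : ℝ) ^ ε * (B.card : ℝ) ^ 2)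

/-- item stmt-ABC-2715 · assembly · rank 1 · open · by planner
sources: Lichtman2025, BombieriGubler2006
[assembly] CountingForm -> ABC. Given eps > 0 pick l with 1/(1+eps) < l < 1 (e.g. l =
(2+eps)/(2+2eps)); CountingForm l gives B with every finite-level count <= B, so the full
exceptional set {(a,b,c) abc triple : rad(abc) < c^l} is finite (nested sets of bounded ncard; B+1
elements would already lie below some X). For non-exceptional triples rad >= c^l hence c <=
rad^{1/l} < 2 rad^{1+eps} (rad >= 1, 1/l < 1+eps); put C := 2 + sum over the finite exceptional set
of c (each exceptional c < C <= C rad^{1+eps}). Elementary; provable now (Set.Finite from uniformly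
bounded ncard of a monotone family, Real.rpow monotonicity). -/
@[route_item "route-ABC-ExceptionalSetEnergy", crux]
def Assembly : Prop :=
  CountingForm → ABC

/-! D-0027 §2.1 — DECIDING THEOREM (planner-authored via `route open/edit --closes-file`; by planner-rrepair-ABC-ExceptionalSetEnergy-7d443791-g2-0 2026-08-15T16:13:18Z):
its hypotheses are this route's items and its conclusion the sub-problem Statement (glue_lint), and it elaborates with this file. -/

@[closes "route-ABC-ExceptionalSetEnergy"] theorem closes (h_CountingForm : CountingForm) (h_HitCountFourSevenths : HitCountFourSevenths) (h_LinearShapeEnergy : LinearShapeEnergy) (h_PowerfulHitsSquareRoot : PowerfulHitsSquareRoot) (h_SquarefulShapeEnergy : SquarefulShapeEnergy) (h_MixedEnergyCauchySchwarz : MixedEnergyCauchySchwarz) (h_PowerfulAlmostSidon : PowerfulAlmostSidon) (h_RadicallySmallNotSidon : RadicallySmallNotSidon) (h_Assembly : Assembly) : _root_.ABC :=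
  h_Assembly h_CountingForm

end Summit.ABC.ABC.Theses.ExceptionalSetEnergy
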